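import Summits.QuantumFields.YangMills.Theorems.BalabanUVNodesK0RecordFormatNames

/-!
# K0⁷ — RECORD-SIDE FORMAT NAMES, LEMMAS 13: the β-chart of `thetaFill` IS THE CHART OF RECORD, and the ε₂₉-FREE, colour-FREE bound
# `‖fun i i' => (thetaFill F a₀ ε₂₉).ρ8 ((thetaFill F a₀ ε₂₉).bV a) i i'‖ ≤ 1` (◆ CRIT-1 g35's (hL3)-assembly prerequisite, nodeO STATUS 2026-08-31T06:46:53Z)

Cell `ym-nodeO-ideate` ∕ `ym-balaban-port`, DEFINER seat `ym-nodeO-def-1` (gen 36); `--kind proof --supports stmt-QuantumFields-20541 --as helper`; count-neutral; THEOREMS ONLY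
(no `def`), about names already in the tree (`thetaFill` = `…K0RecordFormatNames.lean` §9; the chart of record `suChartDim ∕ suChartMap` = `Node00/ChartOfRecord.lean`).
[I] = [Balaban1987RG1].

WHY.  ★ PTB-1 g4's ✓ `PortU8.norm_recordHrLocξ_univ_le` (clause 1 of (‴-LocUniv) at the token letter, `…PortU8LocUnivDecayClause1.lean` :119) carries the constant
`MG163 d · periodConst … · ‖fun i i' : Fin 2 => θ.ρ8 (θ.bV a) i i'‖` at `θ := thetaFill F a₀ ε₂₉`, while the token displays `∃ C₉' δ₉, … ∀ k n ε₂₉, 0 < ε₂₉ → ∀ a μ y b, …` —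
`C₉'` is chosen BEFORE `ε₂₉` and the colour index `a`.  ◆ CRIT-1 g35 (l.4746): «you need ε₂₉-INDEPENDENCE of that norm … projection lemmas `thetaFill_ιβ ∕ _ρ8 ∕ _bV` … OR an
ε-free majorant of `‖ρ8 (bV a)‖` by a named constant»; a cross-ε `rfl` probe is too deep for the kernel.  THIS FILE supplies the majorant, with the constant `1`, by ONE-SIDED
unfolding against the closed chart literal: the Stage-8 part of the `theta13OfThm1CCMWZB` chain is `stage8OfNumericsDZ`, whose β-chart IS the chart of record
(`Vβ := Fin (suChartDim N) → ℝ`, `ρ8 := suChartMap N`, `bV := Pi.basisFun`, ✓ `isChartOfRecord_stage8OfNumericsDZ`), i.e. `IsSuChart … 1`: the basis images are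
Hilbert–Schmidt ORTHONORMAL (`Re Tr(GᴴG) = Σ_{i i'} |G_{i i'}|² = 1`, ✓ `hsForm_apply_self_eq_sum`) ⇒ every matrix entry of `ρ8 (bV a)` has norm ≤ 1, for every `a₀`, `ε₂₉`, `a`.

WHAT THIS FILE IS (theorems only):
* §1 generic chart bookkeeping: `normSq_entry_le_of_isSuChart` ∕ `norm_entry_le_of_isSuChart` (`≤ √c`) ∕ `norm_entry_le_one_of_isSuChart` ∕ `norm_le_one_of_isSuChart` (the
  Pi-norm of `fun i i' => ρ (b a) i i'` is ≤ 1 at `c = 1`).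
* §2 the chart clause of record along the whole z-witness chain: `isChartOfRecord_theta13OfThm1CCMWZB` (all twelve letters) and ★ `isChartOfRecord_thetaFill`.
* §3 ★★ `thetaFill_norm_ρ8_bV_entry_le_one` ∕ ★★ `thetaFill_norm_ρ8_bV_le_one` — THE ε₂₉-FREE, COLOUR-FREE MAJORANT `≤ 1` in exactly the shape of clause 1's constant.
* §4 the type-level projections `thetaFill_Vβ ∕ thetaFill_ιβ` (`rfl` against the closed literals `Fin (suChartDim 2) → ℝ` ∕ `Fin (suChartDim 2)`; cheap in kernel because the
  right-hand side is closed — the expensive direction is comparing two members of the family with different `ε₂₉`).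

HONEST FRAMING.  Linear-algebra bookkeeping about the SHAPE of the β-chart of record (orthonormal basis ⇒ entries ≤ 1); NO estimate of Bałaban's, nothing asserted, ported or
discharged; (‴-LocUniv) clauses 2–4, Tok-cmpU-cap, (C-tab), P0 remain OPEN; 27931 CLOSED·IMPLICATION-ONLY·IN TOTO; 27930 ∕ 26648 OPEN; K0ᴬ ∕ K1ᴬ ∕ K3ᴬ OPEN; NODE O not inhabited
(0∕1); COUNT 8∕28 · K 1∕4 UNMOVED; finite `𝕋⁴_{L^K}` at fixed ε — NOT continuum ∕ ℝ⁴ ∕ OS; **the Yang–Mills mass gap (Clay) is NOT proved by any of this.**  No `sorry`; standard axioms.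
-/

noncomputable section

namespace Summit.QuantumFields.YangMills.Theorems.K0RecordFormatNames

open Literature.MathematicalPhysics.QuantumFieldTheory.Balaban1983to89
open Literature.MathematicalPhysics.QuantumFieldTheory.Balaban1983to89.Node00
open Literature.MathematicalPhysics.QuantumFieldTheory.Balaban1983to89.T4Continuum (T4Family)
open Literature.Algebra.Lie.CompactKillingForm (hsForm hsForm_apply_self_eq_sum)

/-! ## §1  Generic: an `hsForm`-orthonormal chart has basis images with entries of norm ≤ √c -/

section Generic

variable {N : ℕ} {V : Type*} [NormedAddCommGroup V] [NormedSpace ℝ V] {ι : Type*} {ρ : V →L[ℝ] Matrix (Fin N) (Fin N) ℂ}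
  {b : Module.Basis ι ℝ V} {c : ℝ}

/-- At a chart with Hilbert–Schmidt squared norms `c` (`Re Tr(GᴴG) = c`), every ENTRY of a basis image has norm-square ≤ `c` (one term of the double sum
`Σ_{i i'} |G_{i i'}|² = c`). [cite: Hall2015, Example 7.3; Balaban1987RG1, (1.21) p.264 (bookkeeping)] -/
theorem normSq_entry_le_of_isSuChart (h : IsSuChart N ρ b c) (a : ι) (i i' : Fin N) : Complex.normSq (ρ (b a) i i') ≤ c := by
  have hsum : hsForm (Fin N) (ρ (b a)) (ρ (b a)) = c := h.2.2.1 a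
  rw [hsForm_apply_self_eq_sum] at hsum
  calc Complex.normSq (ρ (b a) i i')
      ≤ ∑ j, Complex.normSq (ρ (b a) j i') :=
        Finset.single_le_sum (f := fun j => Complex.normSq (ρ (b a) j i')) (fun j _ => Complex.normSq_nonneg _) (Finset.mem_univ i)
    _ ≤ ∑ i₀, ∑ j, Complex.normSq (ρ (b a) j i₀) :=
        Finset.single_le_sum (f := fun i₀ => ∑ j, Complex.normSq (ρ (b a) j i₀))
          (fun i₀ _ => Finset.sum_nonneg fun j _ => Complex.normSq_nonneg _) (Finset.mem_univ i')
    _ = c := hsum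

/-- … hence every entry has norm ≤ `√c`. [cite: Hall2015, Example 7.3 (bookkeeping)] -/
theorem norm_entry_le_of_isSuChart (h : IsSuChart N ρ b c) (a : ι) (i i' : Fin N) : ‖ρ (b a) i i'‖ ≤ Real.sqrt c := by
  have hsq : ‖ρ (b a) i i'‖ ^ 2 ≤ c := by
    rw [← Complex.normSq_eq_norm_sq]
    exact normSq_entry_le_of_isSuChart h a i i'
  calc ‖ρ (b a) i i'‖ = Real.sqrt (‖ρ (b a) i i'‖ ^ 2) := (Real.sqrt_sq (norm_nonneg _)).symm
    _ ≤ Real.sqrt c := Real.sqrt_le_sqrt hsq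

/-- At the NORMALISATION OF RECORD `c = 1` (orthonormal chart): every entry of a basis image has norm ≤ 1. [cite: Balaban1987RG1, (1.21) p.264 (bookkeeping)] -/
theorem norm_entry_le_one_of_isSuChart (h : IsSuChart N ρ b 1) (a : ι) (i i' : Fin N) : ‖ρ (b a) i i'‖ ≤ 1 := by
  simpa only [Real.sqrt_one] using norm_entry_le_of_isSuChart h a i i'

/-- … and so has the entry table read as a Pi-type vector (sup norm over `(i, i')`): `‖fun i i' => ρ (b a) i i'‖ ≤ 1` — the shape in which clause-1-type constants carry the
chart. [cite: Balaban1987RG1, (1.21) p.264 (bookkeeping)] -/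
theorem norm_le_one_of_isSuChart (h : IsSuChart N ρ b 1) (a : ι) : ‖(fun i i' : Fin N => ρ (b a) i i' : Fin N → Fin N → ℂ)‖ ≤ 1 :=
  (pi_norm_le_iff_of_nonneg zero_le_one).2 fun i => (pi_norm_le_iff_of_nonneg zero_le_one).2 fun i' => norm_entry_le_one_of_isSuChart h a i i'

end Generic

/-! ## §2  The chart clause of record along the z-witness chain and at `thetaFill` -/

variable (F : T4Family)

/-- **Every member of the `θ₁₅ᶜᶜᴹᵂᶻᴮ` family carries THE CHART CLAUSE OF RECORD (`c = 1`)** — its Stage-8 part is `stage8OfNumericsDZ`, charted by `suChartMap N` on the standard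
basis (one-sided unfolding; all twelve letters free). [cite: Balaban1987RG1, (1.20)–(1.21) p.264 (bookkeeping)] -/
theorem isChartOfRecord_theta13OfThm1CCMWZB (N : ℕ) [NeZero N] (j : ℕ) (γ εbg ε₀ ε₂₉ B₃ B₃' a₀ a₁ : ℝ) (Efl logz : B12.RunParams → ℕ → ℝ) :
    (theta13OfThm1CCMWZB F N j γ εbg ε₀ ε₂₉ B₃ B₃' a₀ a₁ Efl logz).toStage8Params.IsChartOfRecord 1 :=
  isChartOfRecord_stage8OfNumericsDZ F N _ _ _ _ _

/-- ★ **`thetaFill F a₀ ε₂₉` carries the chart clause of record (`c = 1`)**, for every `a₀`, `ε₂₉`. [cite: Balaban1987RG1, (1.20)–(1.21) p.264 (bookkeeping)] -/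
theorem isChartOfRecord_thetaFill (a₀ ε₂₉ : ℝ) : (thetaFill F a₀ ε₂₉).toStage8Params.IsChartOfRecord 1 :=
  isChartOfRecord_theta13OfThm1CCMWZB F 2 _ _ _ _ _ _ _ _ _ _ _

/-! ## §3  The ε₂₉-free, colour-free majorant of the chart constant at `thetaFill` -/

/-- ★★ Entrywise: `‖(thetaFill F a₀ ε₂₉).ρ8 ((thetaFill F a₀ ε₂₉).bV a) i i'‖ ≤ 1` for EVERY `a₀ ε₂₉ a i i'` (orthonormal chart of record ⇒ entries ≤ 1).
[cite: Balaban1987RG1, (1.21) p.264 (bookkeeping)] -/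
theorem thetaFill_norm_ρ8_bV_entry_le_one (a₀ ε₂₉ : ℝ) (a : (thetaFill F a₀ ε₂₉).ιβ) (i i' : Fin 2) :
    letI θ := thetaFill F a₀ ε₂₉; letI := θ.instVβ₁; letI := θ.instVβ₂
    ‖θ.ρ8 (θ.bV a) i i'‖ ≤ 1 := by
  letI θ := thetaFill F a₀ ε₂₉; letI := θ.instVβ₁; letI := θ.instVβ₂
  exact norm_entry_le_one_of_isSuChart (isChartOfRecord_thetaFill F a₀ ε₂₉) a i i'

/-- ★★ **THE (hL3)-ASSEMBLY MAJORANT**: `‖fun i i' : Fin 2 => (thetaFill F a₀ ε₂₉).ρ8 ((thetaFill F a₀ ε₂₉).bV a) i i'‖ ≤ 1` for EVERY `a₀ ε₂₉ a` — exactly the chart factor of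
✓ `PortU8.norm_recordHrLocξ_univ_le`'s constant, bounded by the ε₂₉-free, colour-free constant `1` (so `C₉' := MG163 4 · periodConst (kappa163 4) 3` serves before the
`∀ ε₂₉ … ∀ a` binders). [cite: Balaban1987RG1, (1.21) p.264, (4.35) p.290 (bookkeeping)] -/
theorem thetaFill_norm_ρ8_bV_le_one (a₀ ε₂₉ : ℝ) (a : (thetaFill F a₀ ε₂₉).ιβ) :
    letI θ := thetaFill F a₀ ε₂₉; letI := θ.instVβ₁; letI := θ.instVβ₂
    ‖fun i i' : Fin 2 => θ.ρ8 (θ.bV a) i i'‖ ≤ 1 := by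
  letI θ := thetaFill F a₀ ε₂₉; letI := θ.instVβ₁; letI := θ.instVβ₂
  exact norm_le_one_of_isSuChart (isChartOfRecord_thetaFill F a₀ ε₂₉) a

/-! ## §4  Type-level projections of `thetaFill`'s β-layer (closed right-hand sides; `rfl`) -/

/-- The colour-component space of `thetaFill` IS `ℝ^{d(2)}` of the chart of record — the same closed type for every `a₀`, `ε₂₉`. [cite: Balaban1987RG1, (1.20) p.264 (bookkeeping)] -/
theorem thetaFill_Vβ (a₀ ε₂₉ : ℝ) : (thetaFill F a₀ ε₂₉).Vβ = (Fin (suChartDim 2) → ℝ) := rfl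

/-- The colour index of `thetaFill` IS `Fin (suChartDim 2)` — the same closed type for every `a₀`, `ε₂₉`. [cite: Balaban1987RG1, (1.21) p.264 (bookkeeping)] -/
theorem thetaFill_ιβ (a₀ ε₂₉ : ℝ) : (thetaFill F a₀ ε₂₉).ιβ = Fin (suChartDim 2) := rfl

end Summit.QuantumFields.YangMills.Theorems.K0RecordFormatNames

end
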